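import Mathlib
import HarnessLib
import Literature.Probability.MarkovChains.DistinguishingStatistic
import Literature.Probability.MarkovChains.PeskunOrdering

/-!
# The test-function bound `Gap_R ≤ 𝓔(f)/Var_π(f)` (Levin–Peres–Wilmer, Remark 13.8: "any function gives an upper bound on the gap")

HONEST FRAMING: exact (Metropolis-corrected) sampling algorithms for lattice gauge theory; figures
of merit are autocorrelation/cost numbers at stated couplings and volumes; no continuum-physics claim.

Conventions of `PeskunOrdering.lean` (`piInner π g h = ⟨g,h⟩_π`, `dirichletForm π P u = 𝓔_P(u)`,
`spectralGapR π P = Gap_R(P) = inf{𝓔_P(f) : Σ π f = 0, ‖f‖²_π = 1}`) and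
`DistinguishingStatistic.lean` (`lawMean`, `lawVariance`).  Source: D. A. Levin, Y. Peres (with
E. L. Wilmer), *Markov Chains and Mixing Times*, 2nd ed., AMS 2017 [LevinPeres2017], §13.2.1.
Theorem-only (0 definitions, 0 named facts).

* `dirichletForm_sub_const` — `𝓔(f + c) = 𝓔(f)` ("since `𝓔(f) = 𝓔(f + c)` for any constant `c`")
  [cite: LevinPeres2017, §13.2.1 Remark 13.8]; `dirichletForm_const_mul` — `𝓔(cf) = c²𝓔(f)`
  [cite: LevinPeres2017, §13.2.1 (proof of Lemma 13.7, `𝓔(f̃) = 𝓔(f)/‖f‖₂²`)];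
* `piInner_centred_eq_lawVariance` — `‖f − E_π f‖²_π = Var_π(f)`;
* **`spectralGapR_le_dirichletForm_div_lawVariance`** — for a probability vector `π ≥ 0`, `P ≥ 0`
  and any `f` with `Var_π(f) > 0`: `Gap_R(P) ≤ 𝓔(f)/Var_π(f)` — the inequality half of
  [cite: LevinPeres2017, §13.2.1 Remark 13.8 (`γ = min_{Var_π(f) ≠ 0} 𝓔(f)/Var_π(f)`; "Any
  function `f` thus gives an upper bound on the gap `γ`, a frequently useful technique")], stated
  for the variational gap `Gap_R` (which Lemma 13.7 — not formalised — identifies with `γ = 1 − λ₂`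
  for reversible `P`); the EQUALITY (that the infimum is attained, by an eigenfunction) is not
  typed.  `BottleneckRatioSpectralGap.LevinPeres2017_thm_13_10_upper` is the instance `f = f_S`.
-/

namespace Literature.Probability.MarkovChains

open Finset Matrix

variable {X : Type*} [Fintype X]

/-- Shift invariance of the Dirichlet form: `𝓔(f + c) = 𝓔(f)` for a constant `c`.
[cite: LevinPeres2017, §13.2.1 Remark 13.8 ("`𝓔(f) = 𝓔(f + c)` for any constant `c`")] -/
theorem dirichletForm_sub_const (π : X → ℝ) (P : Matrix X X ℝ) (f : X → ℝ) (c : ℝ) :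
    dirichletForm π P (fun x => f x - c) = dirichletForm π P f := by
  unfold dirichletForm
  congr 1
  exact sum_congr rfl fun x _ => sum_congr rfl fun y _ => by ring

/-- Homogeneity: `𝓔(c f) = c² 𝓔(f)`. [cite: LevinPeres2017, §13.2.1 (proof of Lemma 13.7:
`𝓔(f̃) = 𝓔(f)/‖f‖₂²` for `f̃ = f/‖f‖₂`)] -/
theorem dirichletForm_const_mul (π : X → ℝ) (P : Matrix X X ℝ) (c : ℝ) (f : X → ℝ) :
    dirichletForm π P (fun x => c * f x) = c ^ 2 * dirichletForm π P f := by
  unfold dirichletForm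
  have h : ∀ x y, π x * P x y * (c * f x - c * f y) ^ 2 = c ^ 2 * (π x * P x y * (f x - f y) ^ 2) :=
    fun x y => by ring
  simp_rw [h, ← mul_sum]
  ring

/-- `‖f − E_π f‖²_π = Var_π(f)`. [cite: LevinPeres2017, §13.2.1 Remark 13.8
(`𝓔(f − E_π(f))/‖f − E_π(f)‖₂² = 𝓔(f)/Var_π(f)`)] -/
theorem piInner_centred_eq_lawVariance (π : X → ℝ) (f : X → ℝ) :
    piInner π (fun x => f x - lawMean π f) (fun x => f x - lawMean π f) = lawVariance π f := by
  unfold piInner lawVariance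
  exact sum_congr rfl fun x _ => by ring

/-- The centred function has `π`-mean zero: `Σ_x π(x)(f(x) − E_π f) = 0` for a probability vector.
[cite: LevinPeres2017, §13.2.1 Remark 13.8 (`f − E_π(f) ⊥_π 1`)] -/
theorem sum_mul_sub_lawMean {π : X → ℝ} (hπ1 : ∑ x, π x = 1) (f : X → ℝ) :
    ∑ x, π x * (f x - lawMean π f) = 0 := by
  unfold lawMean
  simp_rw [mul_sub, sum_sub_distrib, ← sum_mul, hπ1, one_mul, sub_self]

/-- **Remark 13.8 (test-function bound): `Gap_R(P) ≤ 𝓔(f)/Var_π(f)`** for every `f` with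
`Var_π(f) > 0`, for a probability vector `π ≥ 0` and `P ≥ 0` — "any function `f` thus gives an
upper bound on the gap".  (Typed for the variational gap `Gap_R = inf{𝓔(g) : g ⊥_π 1, ‖g‖_π = 1}`
of `PeskunOrdering.lean`; its identification with `γ = 1 − λ₂` for reversible `P` is Lemma 13.7,
not formalised, and the attainment of the infimum is not claimed.)
[cite: LevinPeres2017, §13.2.1 Remark 13.8] -/
theorem spectralGapR_le_dirichletForm_div_lawVariance {π : X → ℝ} (hπ0 : ∀ x, 0 ≤ π x)
    (hπ1 : ∑ x, π x = 1) {P : Matrix X X ℝ} (hP0 : ∀ x y, 0 ≤ P x y) {f : X → ℝ}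
    (hf : 0 < lawVariance π f) :
    spectralGapR π P ≤ dirichletForm π P f / lawVariance π f := by
  set V := lawVariance π f with hV
  set m := lawMean π f with hm
  set c : ℝ := 1 / Real.sqrt V with hc
  have hc2 : c ^ 2 = 1 / V := by rw [hc, div_pow, one_pow, Real.sq_sqrt hf.le]
  set g : X → ℝ := fun x => c * (f x - m) with hg
  -- admissibility of `g = (f − E_π f)/√Var_π(f)`
  have hg0 : ∑ x, π x * g x = 0 := by
    have : ∑ x, π x * g x = c * ∑ x, π x * (f x - m) := by
      rw [mul_sum]; exact sum_congr rfl fun x _ => by simp only [hg]; ring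
    rw [this, hm, sum_mul_sub_lawMean hπ1 f, mul_zero]
  have hg1 : piInner π g g = 1 := by
    have : piInner π g g = c ^ 2 * piInner π (fun x => f x - m) (fun x => f x - m) := by
      unfold piInner; rw [mul_sum]; exact sum_congr rfl fun x _ => by simp only [hg]; ring
    rw [this, hm, piInner_centred_eq_lawVariance, ← hV, hc2, one_div, inv_mul_cancel₀ hf.ne']
  -- its energy `𝓔(g) = 𝓔(f)/Var_π(f)`
  have hE : dirichletForm π P g = c ^ 2 * dirichletForm π P f := by
    have h1 : dirichletForm π P g = c ^ 2 * dirichletForm π P (fun x => f x - m) :=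
      dirichletForm_const_mul π P c _
    rw [h1, dirichletForm_sub_const]
  calc spectralGapR π P ≤ dirichletForm π P g := spectralGapR_le_dirichletForm hπ0 hP0 hg0 hg1
    _ = dirichletForm π P f / lawVariance π f := by rw [hE, hc2, ← hV]; ring

end Literature.Probability.MarkovChains
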